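import Literature.Topology.FourManifolds.LickorishTwistLink
import Literature.Topology.FourManifolds.LickorishWallaceProofs
import Literature.Topology.FourManifolds.HeegaardSplittingMorse
import Literature.Topology.FourManifolds.LickorishWallaceSphereGluingProofs
import Literature.Topology.FourManifolds.CollarTheorem
import Literature.Topology.FourManifolds.IsotopyProofs
import Literature.Topology.FourManifolds.ManifoldULift
import Literature.Topology.FourManifolds.ClosedBallProofs
import HarnessLib

/-!
# F4 of the Lickorish–Wallace DAG from the uniqueness of gluings

Topic `Literature/Topology/FourManifolds`; fact seat of `Literature.Topology.FourManifolds.exists_isIntegralSurgeryLink`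
(**spc4.S22**, the Lickorish–Wallace theorem). The DAG of `LickorishWallace.lean` reduces the fact to
F1 (Heegaard splittings), F2a (proved), F2b (⇐ UNIQ + SPLIT + SYMM, `LickorishWallaceHandlebodies.lean`),
F3 (Dehn–Lickorish) and **F4**
(`exists_isIntegralSurgeryLink_of_isBoundaryGluing_of_isIsotopic_listProd`: if `Y = H ∪_f H'`,
`S³ = H ∪_i H'` and `f⁻¹ ∘ i` is isotopic to a product of Dehn twists, then `Y` is integral surgery
on a framed link in `S³`; Lickorish, Ann. of Math. 76 (1962), proof of Thm. 2, pp. 538–540). This file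
**proves F4 from the uniqueness of gluings** UG
(`Literature.Topology.FourManifolds.nonempty_diffeomorph_of_isBoundaryGluing`, `Gluing.lean`; Hirsch
(1976), Ch. 8 Thm. 2.1; Bröcker–Jänich (1982), §13), packaged with the standard manifold instances as
`nonempty_diffeomorph_of_isBoundaryGluing_dimThree`:

* `exists_isIntegralSurgeryLink_of_isBoundaryGluing_of_isIsotopic_listProd_of_UG : nonempty_diffeomorph_of_isBoundaryGluing_dimThree → F4`.
  Proof: for `g = τₙ ∘ ⋯ ∘ τ₁` the surgeries of `LickorishTwistLink.lean` along the inverse twists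
  give a closed `P : Type` which is both `H ∪_{i ∘ g⁻¹} H'` and integral surgery on an `n`-component
  framed link in `S³`; `f⁻¹ ∘ i ≃ g` makes `f⁻¹ ∘ i ∘ g⁻¹` isotopic to the identity of the closed
  connected surface `∂H` (`IsHandlebody.connectedSpace_boundary_holds`), hence diffeotopic to it
  (`Diffeomorph.IsIsotopic.isDiffeotopicToId`, `EquidimensionalEmbedding.lean`), so it extends over `H`
  (`BoundaryData.diffeoExtends_of_isDiffeotopicToId_holds`, the collar theorem, `CollarTheorem.lean`)
  and `Y = H ∪_{i ∘ g⁻¹} H'` too (`IsBoundaryGluing.comp_diffeomorph`); by UG `Y ≅ ULift P ≅ P`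
  (`ManifoldULift.lean`), and surgery presentations transport (`IsIntegralSurgeryLink.of_diffeomorph`).
* `exists_isIntegralSurgeryLink_of_leaves` — the Lickorish–Wallace theorem from the remaining leaves
  SELFIDX (`exists_isMorse_isSelfIndexing 3`), GENUS, UNIQ, F3, UG (F2a, SPLIT, SYMM being discharged
  in the tree, `exists_isIntegralSurgeryLink_of_lickorish''''`).
* Isotopy algebra: `Diffeomorph.IsIsotopic.trans_left`; `coe_listProd_symm`.

No unproved statement is asserted beyond the hypotheses; `nonempty_diffeomorph_of_isBoundaryGluing_dimThree` is the quantified form of the named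
fact it abbreviates. Everything here is proved.

## References

* W. B. R. Lickorish, Ann. of Math. 76 (1962), Thm. 2 and its proof (pp. 538–540). [LickorishAnnals1962]
* M. W. Hirsch, *Differential Topology*, GTM 33 (1976), Ch. 8, Thm. 2.1. [HirschDT1976]
* T. Bröcker, K. Jänich, *Introduction to Differential Topology* (1982), §13.
-/

open scoped Manifold ContDiff Topology
open Set Function Metric

noncomputable section

namespace Literature.Topology.FourManifolds

open LickorishTwist

universe u

/-- Local notation: `𝔼 n` is the model Euclidean space `EuclideanSpace ℝ (Fin n)`. -/
local notation "𝔼 " n:arg => EuclideanSpace ℝ (Fin n)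

/-! ### Isotopy algebra -/

section IsotopyAlgebra

variable {E H : Type*} [NormedAddCommGroup E] [NormedSpace ℝ E] [TopologicalSpace H]
  {J : ModelWithCorners ℝ E H} {N : Type*} [TopologicalSpace N] [ChartedSpace H N] [IsManifold J ∞ N]

/-- **Isotopy is compatible with precomposition**: if `φ ≃ ψ` then `χ.trans φ ≃ χ.trans ψ` (compose the
isotopy stagewise with `χ`). Hirsch (1976), §8.1. [folklore] -/
theorem Diffeomorph.IsIsotopic.trans_left (χ : N ≃ₘ⟮J, J⟯ N) {φ ψ : N ≃ₘ⟮J, J⟯ N} (h : Diffeomorph.IsIsotopic φ ψ) :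
    Diffeomorph.IsIsotopic (χ.trans φ) (χ.trans ψ) := by
  obtain ⟨F⟩ := h
  refine ⟨⟨fun t ↦ F.toFun t ∘ χ, ?_, fun t ↦ (F.isSmoothEmbedding t).comp_diffeomorph χ, ?_, ?_⟩⟩
  · exact F.contMDiff.comp (contMDiff_fst.prodMk (χ.contMDiff.comp contMDiff_snd))
  · funext x; simp [F.map_zero, Diffeomorph.coe_trans]
  · funext x; simp [F.map_one, Diffeomorph.coe_trans]

end IsotopyAlgebra

/-! ### Products of lists of twists and their inverses -/

namespace LickorishTwist

section ListProd

variable {E H : Type*} [NormedAddCommGroup E] [NormedSpace ℝ E] [TopologicalSpace H]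
  {I : ModelWithCorners ℝ E H} {X : Type*} [TopologicalSpace X] [ChartedSpace H X]

/-- **The inverse of a product of twists is the composite of the inverses in list order**:
`(listProd [τ₁, …, τₙ])⁻¹ = τ₁⁻¹ ∘ ⋯ ∘ τₙ⁻¹ = compList [τ₁⁻¹, …, τₙ⁻¹]`. [folklore] -/
theorem coe_listProd_symm (l : List (X ≃ₘ⟮I, I⟯ X)) :
    (⇑(Diffeomorph.listProd l).symm : X → X) =
      compList ((l.map Diffeomorph.symm).map fun σ : X ≃ₘ⟮I, I⟯ X ↦ (σ : X → X)) := by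
  induction l with
  | nil => funext x; rfl
  | cons τ l ih =>
    funext x
    simp only [Diffeomorph.listProd_cons, List.map_cons, compList_cons, comp_apply]
    rw [← ih]
    rfl

end ListProd

end LickorishTwist

/-! ### F4 from the uniqueness of gluings -/

section F4

/-- **Uniqueness of gluings in dimension three (UG)**, as consumed here: the named fact
`Literature.Topology.FourManifolds.nonempty_diffeomorph_of_isBoundaryGluing` of `Gluing.lean` at
`n = 2`, universally closed over compact smooth `3`-manifolds with boundary `M`, `N` (Hausdorff,
second countable, `IsManifold (𝓡∂ 3) ∞`), their boundary data, and smooth (Hausdorff, second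
countable) glued manifolds `P`, `P'` in `Type u` — the binders of the tree's precedent
`nonempty_diffeomorph_of_isBoundaryGluing_twoHandlebody` (`SPC4Handles.lean`): *two smooth
manifolds each obtained by gluing `M` and `N` along the same boundary diffeomorphism are
diffeomorphic*. Hirsch, *Differential Topology* (1976), Ch. 8, Thm. 2.1; Bröcker–Jänich (1982), §13.
[cite: HirschDT1976, Ch. 8 Thm. 2.1] -/
def nonempty_diffeomorph_of_isBoundaryGluing_dimThree : Prop :=
  ∀ (M N : Type u) [TopologicalSpace M] [T2Space M] [SecondCountableTopology M] [CompactSpace M]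
    [ChartedSpace (EuclideanHalfSpace 3) M] [IsManifold (𝓡∂ 3) ∞ M]
    [TopologicalSpace N] [T2Space N] [SecondCountableTopology N] [CompactSpace N]
    [ChartedSpace (EuclideanHalfSpace 3) N] [IsManifold (𝓡∂ 3) ∞ N]
    (bM : BoundaryData (𝓡∂ 3) M (𝓡 2)) (bN : BoundaryData (𝓡∂ 3) N (𝓡 2))
    (P P' : Type u) [TopologicalSpace P] [T2Space P] [SecondCountableTopology P] [ChartedSpace (𝔼 3) P]
    [IsManifold (𝓡 3) ∞ P] [TopologicalSpace P'] [T2Space P'] [SecondCountableTopology P']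
    [ChartedSpace (𝔼 3) P'] [IsManifold (𝓡 3) ∞ P'],
    nonempty_diffeomorph_of_isBoundaryGluing (n := 2) (bM := bM) (bN := bN) (P := P) (P' := P')

/-- **F4 of the Lickorish–Wallace DAG** (`Literature.Topology.FourManifolds.exists_isIntegralSurgeryLink_of_isBoundaryGluing_of_isIsotopic_listProd`,
Lickorish's surgery realisation of Dehn twists; Ann. of Math. 76 (1962), proof of Thm. 2,
pp. 538–540, Fig. 11; Schultens (2014), Lemma 7.3.4) **from the uniqueness of gluings (UG)**.
Proof: write the product of twists `g = τₙ ∘ ⋯ ∘ τ₁`; by `exists_surgery_of_dehnTwists` (applied to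
the inverse twists, at doubling collar depths) there is a closed `3`-manifold `P` which is both
`H ∪_{i ∘ g⁻¹} H'` and integral surgery on a framed `n`-component link in `S³`; since
`f⁻¹ ∘ i ≃ g`, the diffeomorphism `f⁻¹ ∘ i ∘ g⁻¹` of `∂H` is isotopic, hence (closed connected
surface, `Diffeomorph.IsIsotopic.isDiffeotopicToId`) diffeotopic, to the identity, so it extends
over `H` (`BoundaryData.diffeoExtends_of_isDiffeotopicToId_holds`, the collar theorem) and `Y` is
also `H ∪_{i ∘ g⁻¹} H'` (`IsBoundaryGluing.comp_diffeomorph`); by UG, `Y ≅ P` (through `ULift P`,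
`IsBoundaryGluing.diffeomorph_comp`), and surgery presentations transport along diffeomorphisms
(`IsIntegralSurgeryLink.of_diffeomorph`).
[cite: LickorishAnnals1962, proof of Thm. 2 (pp. 538–540, Fig. 11)] -/
theorem exists_isIntegralSurgeryLink_of_isBoundaryGluing_of_isIsotopic_listProd_of_UG (hUG : nonempty_diffeomorph_of_isBoundaryGluing_dimThree.{u}) :
    exists_isIntegralSurgeryLink_of_isBoundaryGluing_of_isIsotopic_listProd.{u} := by
  intro Y _ _ _ _ _ _ _ hY g H _ _ _ _ _ H' _ _ _ _ _ hH hH' b b' f i hf hi l hl hiso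
  -- instances on the pieces and the boundary surface
  haveI : CompactSpace H := hH.compactSpace
  haveI : CompactSpace H' := hH'.compactSpace
  haveI : CompactSpace b.carrier := b.compactSpace_carrier
  haveI : T2Space b.carrier := b.t2Space_carrier
  haveI : ConnectedSpace b.carrier := IsHandlebody.connectedSpace_boundary_holds g H hH b
  -- a collar of `∂H`, the explicit gluing `S³ = H ∪_i H'`
  obtain ⟨c⟩ := BoundaryData.nonempty_collar_of_compactSpace 1 H b
  obtain ⟨jH₀, jH₀', h₀⟩ := hi
  have h₀' : IsBoundaryGluingWith b b' i (𝓡 3) jH₀ jH₀' := h₀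
  -- surgeries realising the inverse twists
  set lσ : List (b.carrier ≃ₘ⟮𝓡 2, 𝓡 2⟯ b.carrier) := l.map Diffeomorph.symm with hlσ_def
  have hlσ : ∀ σ ∈ lσ, IsDehnTwist (𝓡 2) σ := by
    intro σ hσ
    rw [hlσ_def, List.mem_map] at hσ
    obtain ⟨τ, hτ, rfl⟩ := hσ
    exact (hl τ hτ).symm
  obtain ⟨P, _, _, _, _, _, jH, jH', hP, L, m, hLm⟩ := exists_surgery_of_dehnTwists c h₀' lσ hlσ
  -- the glued map is `i ∘ g⁻¹ = ⇑f'`, `f' := g.symm.trans i`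
  set gp := Diffeomorph.listProd l with hgp
  set f' : b.carrier ≃ₘ⟮𝓡 2, 𝓡 2⟯ b'.carrier := gp.symm.trans i with hf'
  have hcomp : (⇑i ∘ compList (lσ.map fun σ : b.carrier ≃ₘ⟮𝓡 2, 𝓡 2⟯ b.carrier ↦ (σ : b.carrier → b.carrier))) =
      ⇑f' := by rw [hlσ_def, ← coe_listProd_symm]; rfl
  rw [hcomp] at hP
  -- `f⁻¹ ∘ i ∘ g⁻¹` is isotopic to the identity, hence extends over `H`
  set ψ' : b.carrier ≃ₘ⟮𝓡 2, 𝓡 2⟯ b.carrier := gp.symm.trans (i.trans f.symm) with hψ'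
  have hiso' : Diffeomorph.IsIsotopic (Diffeomorph.refl (𝓡 2) b.carrier ∞) ψ' := by
    have h1 : Diffeomorph.IsIsotopic (gp.symm.trans (i.trans f.symm)) (gp.symm.trans gp) := hiso.trans_left gp.symm
    rw [Diffeomorph.symm_trans_self] at h1
    exact h1.symm
  have hdt : Diffeomorph.IsDiffeotopicToId ψ' := Diffeomorph.IsIsotopic.isDiffeotopicToId hiso'
  obtain ⟨Φ, hΦ⟩ := (BoundaryData.diffeoExtends_iff b ψ').1
    (BoundaryData.diffeoExtends_of_isDiffeotopicToId_holds 2 H b ψ' hdt)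
  -- `Y = H ∪_{f'} H'` as well (`IsBoundaryGluing.comp_diffeomorph`, `CerfGammaFourProofs.lean`)
  have hY2 : IsBoundaryGluing b b' f' (𝓡 3) Y :=
    hf.comp_diffeomorph Φ ψ'.toEquiv (fun z ↦ congrFun hΦ z) fun z ↦ by
      simp [hψ', hf', Diffeomorph.coe_trans]
  -- uniqueness of the gluing: `Y ≅ ULift P ≅ P` (`IsBoundaryGluing.diffeomorph_comp`,
  -- `CorkDecompositionSplitting.lean`, transports the presentation of `P` to `ULift P`)
  haveI : SecondCountableTopology P := ChartedSpace.secondCountable_of_sigmaCompact (𝔼 3) P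
  set eP := ManifoldULift.diffeomorph (𝓡 3) P ∞ with heP
  have hP' : IsBoundaryGluing b b' f' (𝓡 3) (ULift.{u} P) := hP.isBoundaryGluing.diffeomorph_comp eP.symm
  obtain ⟨e₁⟩ := hUG H H' b b' Y (ULift.{u} P) hY2 hP'
  exact ⟨lσ.length, L, m, hLm.of_diffeomorph (e₁.trans eP).symm⟩

/-! ### The Lickorish–Wallace theorem from the remaining leaves -/

/-- **The Lickorish–Wallace theorem (spc4.S22, `Literature.Topology.FourManifolds.exists_isIntegralSurgeryLink`)
from the remaining named facts of its DAG** (F4 discharged modulo UG by this file; F2a, SPLIT,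
SYMM discharged in the tree, `LickorishWallaceSphereGluingProofs.lean`): the self-indexing Morse function
(`exists_isMorse_isSelfIndexing 3`, Milnor 1965), the genus of a handlebody boundary
(`IsHandlebody.genus_eq_of_diffeomorph_boundary`), the classification of handlebodies (UNIQ,
`IsHandlebody.nonempty_diffeomorph`), the Dehn–Lickorish theorem (F3) and the uniqueness of gluings
(UG).
[cite: LickorishAnnals1962, Thm. 2 and its proof (pp. 538–540)] -/
theorem exists_isIntegralSurgeryLink_of_leaves
    (hSI : FourManifolds.exists_isMorse_isSelfIndexing.{u} 3)
    (hG : IsHandlebody.genus_eq_of_diffeomorph_boundary.{u})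
    (hU : IsHandlebody.nonempty_diffeomorph.{u})
    (h₃ : exists_isDehnTwist_isIsotopic_listProd.{u}) (hUG : nonempty_diffeomorph_of_isBoundaryGluing_dimThree.{u}) :
    FourManifolds.exists_isIntegralSurgeryLink.{u} :=
  exists_isIntegralSurgeryLink_of_lickorish'''' (exists_isHeegaardSplitting_of_isSelfIndexing_of_genus_eq hSI hG)
    hU h₃ (exists_isIntegralSurgeryLink_of_isBoundaryGluing_of_isIsotopic_listProd_of_UG hUG)

end F4

end Literature.Topology.FourManifolds
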